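import Literature.MathematicalPhysics.KineticTheory.CollisionTubeVarianceRung0
import HarnessLib

/-!
# Crux `JParityClosure.EvenStressEnskog` (stmt-AtomisticToContinuum-13079), line
# `even-rung-mean-variance`: helper stub `stub_tubeVarianceRung0_of_plateau2` ((hA) at rung 0 modulo the plateau)

The STATIC tube-variance input (hA)₀ of `fixedTimeVariance_rung0_of_static`
(`…Theorems/JParityClosureEvenStressEnskogFixedTimeVarianceReduction.lean`): for constant profiles
`(a, u, θ)` the canonical variance of the collision-tube functional
`A_t = tubeStat σ N χ g (Ξ_L^{kl}) r r 1 κ t` is `≤ ς` for `N ≥ N₀(ς, r, L, κ, …)`, uniformly in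
`t ∈ [0, τ]` and the mark indices — GIVEN the plateau hypothesis (Plateau'): relative asymptotic
independence of two disjoint decorated dimers `h(xᵢ)𝟙_T(xⱼ − xᵢ)`, `h'(x_k)𝟙_{T'}(x_l − x_k)` under the
activity-`1` canonical configurational measure `P_N`, with an error `ζ · vol(T) vol(T')` for `N ≥ N₀(σ, ζ)`.

Proof: the Literature bound `variance_tubeStat_rung0_le` (`Literature/…/CollisionTubeVarianceRung0`:
density-weight replacement by the uniform density LLN, Efron–Stein in the velocities at fixed positions
with hard-sphere packing, the Ruelle pair/triple bounds for the shared-label covariances, and the plateau —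
extended from indicators to the velocity-averaged tube mark by a discrete layer cake — for the disjoint
pairs) reads `Var_{G_N}(A_t) ≤ K₁/(N+1) + K₂ ζ + K₃ ζ'² + K₄ P_N(Bad_N(δ, r))` with constants depending on
`(L, κ, sup|χ|, sup|g|, σ)` only; choose `ζ`, then `ζ'` (continuity of `g` at `σ³` gives `δ`), then
`N₀` (plateau, `ε_N → 0`, the uniform density LLN `exists_posGibbs_sqDevEvent_le`, and `K₁/(N+1)`).
Quantifiers: `η₀ = 1`, `σ₀ = min σ₁ σ₂` (plateau, small density), `r₀ = 1/4`.

References: H. Spohn, *Large Scale Dynamics of Interacting Particles* (1991), Part I §2.3; D. Ruelle,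
*Statistical Mechanics: Rigorous Results* (1969), §4.2; S. Boucheron, O. Bousquet, G. Lugosi (2004) §2.
-/

noncomputable section

open MeasureTheory ProbabilityTheory Set Filter Topology
open scoped ENNReal

namespace Summit.AtomisticToContinuum.HydrodynamicLimit.Theorems.EvenStressEnskog

open Literature.Analysis.FluidPDE Literature.MathematicalPhysics.KineticTheory

/-! ### Elementary choices of small parameters -/

/-- For `K ≥ 0` and `e > 0` there is `ζ > 0` with `ζ ≤ 1` and `K ζ ≤ e`. [folklore] -/
theorem exists_pos_mul_le {K e : ℝ} (hK : 0 ≤ K) (he : 0 < e) : ∃ ζ : ℝ, 0 < ζ ∧ ζ ≤ 1 ∧ K * ζ ≤ e := by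
  refine ⟨min 1 (e / (K + 1)), lt_min one_pos (div_pos he (by linarith)), min_le_left _ _, ?_⟩
  calc K * min 1 (e / (K + 1)) ≤ K * (e / (K + 1)) := mul_le_mul_of_nonneg_left (min_le_right _ _) hK
    _ ≤ (K + 1) * (e / (K + 1)) := mul_le_mul_of_nonneg_right (by linarith) (div_nonneg he.le (by linarith))
    _ = e := by field_simp

/-- For `e > 0` there is `N₀` with `K / (N + 1) ≤ e` for `N ≥ N₀`. [folklore] -/
theorem exists_nat_div_succ_le (K : ℝ) {e : ℝ} (he : 0 < e) :
    ∃ N₀ : ℕ, ∀ N : ℕ, N₀ ≤ N → K / ((N + 1 : ℕ) : ℝ) ≤ e := by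
  obtain ⟨N₀, hN₀⟩ := exists_nat_ge (K / e)
  refine ⟨N₀, fun N hN => ?_⟩
  have hN1 : K / e ≤ ((N + 1 : ℕ) : ℝ) := hN₀.trans (by exact_mod_cast hN.trans (Nat.le_succ N))
  rw [div_le_iff₀ (by positivity)]
  rw [div_le_iff₀ he] at hN1
  linarith [mul_comm e (((N + 1 : ℕ) : ℝ))]

/-- A continuous `χ` on `ℝ × 𝕋³` is bounded on `[0, τ] × 𝕋³` by a positive constant. [folklore] -/
theorem exists_pos_bound_on_strip {χ : ℝ × UnitAddTorus (Fin 3) → ℝ} (hχ : Continuous χ) (τ : ℝ) :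
    ∃ C : ℝ, 0 < C ∧ ∀ t ∈ Set.Icc (0 : ℝ) τ, ∀ y, |χ (t, y)| ≤ C := by
  obtain ⟨C, hC⟩ := ((isCompact_Icc (a := (0 : ℝ)) (b := τ)).prod isCompact_univ).exists_bound_of_continuousOn
    hχ.continuousOn
  refine ⟨max C 0 + 1, by positivity, fun t ht y => ?_⟩
  have h := hC (t, y) ⟨ht, mem_univ _⟩
  rw [Real.norm_eq_abs] at h
  linarith [le_max_left C 0]

/-- A continuous `g` vanishing on `[1, ∞)` is bounded on `[0, ∞)`. [folklore] -/
theorem exists_bound_of_vanishing {g : ℝ → ℝ} (hg : Continuous g) (hg0 : ∀ a', (1 : ℝ) ≤ a' → g a' = 0) :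
    ∃ C : ℝ, ∀ y, 0 ≤ y → |g y| ≤ C := by
  obtain ⟨C, hC⟩ := (isCompact_Icc (a := (0 : ℝ)) (b := 1)).exists_bound_of_continuousOn hg.continuousOn
  refine ⟨max C 0, fun y hy => ?_⟩
  by_cases h1 : y ≤ 1
  · have h := hC y ⟨hy, h1⟩
    rw [Real.norm_eq_abs] at h
    exact h.trans (le_max_left _ _)
  · rw [hg0 y (not_le.1 h1).le, abs_zero]; exact le_max_right _ _

/-- A continuity modulus of `g` at `σ³` in the multiplicative form consumed by
`variance_tubeStat_rung0_le`: for `ζ' > 0` there is `δ > 0` with `|g(σ³y) − g(σ³)| ≤ ζ'` whenever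
`|y − 1| < δ` (`σ > 0`). [folklore] -/
theorem exists_modulus_at_cube {g : ℝ → ℝ} (hg : Continuous g) {σ : ℝ} (hσ : 0 < σ) {ζ' : ℝ} (hζ' : 0 < ζ') :
    ∃ δ : ℝ, 0 < δ ∧ ∀ y, 0 ≤ y → |y - 1| < δ → |g (σ ^ 3 * y) - g (σ ^ 3)| ≤ ζ' := by
  obtain ⟨δ₀, hδ₀, h⟩ := Metric.continuous_iff.1 hg (σ ^ 3) ζ' hζ'
  have hσ3 : 0 < σ ^ 3 := by positivity
  refine ⟨δ₀ / σ ^ 3, div_pos hδ₀ hσ3, fun y _ hy => le_of_lt ?_⟩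
  have hd : dist (σ ^ 3 * y) (σ ^ 3) < δ₀ := by
    rw [Real.dist_eq, show σ ^ 3 * y - σ ^ 3 = σ ^ 3 * (y - 1) by ring, abs_mul, abs_of_pos hσ3]
    rwa [lt_div_iff₀ hσ3, mul_comm] at hy
  have := h _ hd
  rwa [Real.dist_eq] at this

/-- Eventually `ε_N · c < 1/2` (`ε_N → 0`). [folklore] -/
theorem exists_hsDiameter_mul_lt (σ c : ℝ) :
    ∃ N₀ : ℕ, ∀ N : ℕ, N₀ ≤ N → hsDiameter σ N * c < 1 / 2 := by
  have ht : Tendsto (fun N => hsDiameter σ N * c) atTop (𝓝 (0 * c)) := (tendsto_hsDiameter σ).mul_const c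
  rw [zero_mul] at ht
  obtain ⟨N₀, hN₀⟩ := eventually_atTop.1 (ht (Iio_mem_nhds (by norm_num : (0 : ℝ) < 1 / 2)))
  exact ⟨N₀, fun N hN => hN₀ N hN⟩

/-! ### The registered stub -/

/-- **Registered helper stub `stub_tubeVarianceRung0_of_plateau2`** (crux stmt-AtomisticToContinuum-13079,
line `even-rung-mean-variance`): the plateau hypothesis (Plateau') — relative asymptotic independence of two
disjoint decorated dimers under the activity-`1` canonical configurational measure, with bounded
absolute-position weights — implies the static tube-variance input (hA)₀ of
`fixedTimeVariance_rung0_of_static` (the variance bookkeeping is `variance_tubeStat_rung0_le`). [folklore] -/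
theorem stub_tubeVarianceRung0_of_plateau2 : (∃ σ₁ : ℝ, 0 < σ₁ ∧ ∀ σ : ℝ, 0 < σ → σ < σ₁ → ∀ ζ : ℝ, 0 < ζ → ∃ N₀ : ℕ, ∀ N : ℕ, N₀ ≤ N → ∀ i j k l : Fin (N + 1), i ≠ j → i ≠ k → i ≠ l → j ≠ k → j ≠ l → k ≠ l → ∀ (h h' : T3 → ℝ), Measurable h → Measurable h' → (∀ y, |h y| ≤ 1) → (∀ y, |h' y| ≤ 1) → ∀ T T' : Set T3, MeasurableSet T → MeasurableSet T' → |(∫ x, h (x i) * T.indicator (fun _ => (1 : ℝ)) (x j - x i) * (h' (x k) * T'.indicator (fun _ => (1 : ℝ)) (x l - x k)) ∂posGibbsMeasure (fun _ : T3 => (1 : ℝ)) (hsDiameter σ N) (N + 1)) - (∫ x, h (x i) * T.indicator (fun _ => (1 : ℝ)) (x j - x i) ∂posGibbsMeasure (fun _ : T3 => (1 : ℝ)) (hsDiameter σ N) (N + 1)) * (∫ x, h' (x k) * T'.indicator (fun _ => (1 : ℝ)) (x l - x k) ∂posGibbsMeasure (fun _ : T3 => (1 : ℝ)) (hsDiameter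 σ N) (N + 1))| ≤ ζ * (MeasureTheory.volume T).toReal * (MeasureTheory.volume T').toReal) → ∃ η₀ : ℝ, 0 < η₀ ∧ ∀ (a θ : ℝ) (u : V3), 0 < a → 0 < θ → ∃ σ₀ : ℝ, 0 < σ₀ ∧ ∀ σ : ℝ, 0 < σ → σ < σ₀ → ∀ Φ : (N : ℕ) → HardSphereFlow (Torus.geometry (Fin 3)) (hsDiameter σ N) (N + 1), ∀ τ : ℝ, 0 < τ → ∀ χ : ℝ × UnitAddTorus (Fin 3) → ℝ, Continuous χ → ∀ g : ℝ → ℝ, Continuous g → (∀ a', η₀ ≤ a' → g a' = 0) → ∀ ς : ℝ, 0 < ς → ∃ r₀ : ℝ, 0 < r₀ ∧ ∀ r : ℝ, 0 < r → r < r₀ → ∀ L κ : ℝ, 1 ≤ L → 0 < κ → κ ≤ 1 → ∃ N₀ : ℕ, ∀ N : ℕ, N₀ ≤ N → ∀ k l : Fin 3, ∀ t ∈ Set.Icc (0 : ℝ) τ, ProbabilityTheory.variance (fun z => tubeStat σ N χ g (evenMarkTrunc k l L) r r 1 κ t z) (localGibbsLaw σ (fun _ => a) (fun _ => u) (fun _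 => θ) N (Φ N)) ≤ ς := by
  intro hPl
  obtain ⟨σ₁, hσ₁, hPl⟩ := hPl
  refine ⟨1, one_pos, ?_⟩
  intro a θ u ha hθ
  obtain ⟨σ₂, hσ₂, hsmall⟩ := exists_smallDensity uniformProfile one_pos
  refine ⟨min σ₁ σ₂, lt_min hσ₁ hσ₂, ?_⟩
  intro σ hσ hσlt Φ τ hτ χ hχ g hg hg0 ς hς
  have hsd : SmallDensity uniformProfile σ := (hsmall σ hσ (lt_of_lt_of_le hσlt (min_le_right _ _))).1
  have hσ1 : σ < σ₁ := lt_of_lt_of_le hσlt (min_le_left _ _)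
  refine ⟨1 / 4, by norm_num, ?_⟩
  intro r hr hr4 L κ hL hκ hκ1
  have hL0 : 0 < L := one_pos.trans_le hL
  have hr2 : r < 1 / 2 := hr4.trans (by norm_num)
  -- the constants
  obtain ⟨Cχ, hCχ, hχb⟩ := exists_pos_bound_on_strip hχ τ
  obtain ⟨Cg, hCg⟩ := exists_bound_of_vanishing hg hg0
  set Cp : ℝ := (3 + 4 * L * κ) ^ 3 with hCp
  set VL : ℝ := 4 / 3 * Real.pi * (1 + 2 * L * κ) ^ 3 with hVL
  set K₁ : ℝ := 2 * (Cg * Cχ / κ) ^ 2 *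
    (64 * L ^ 2 * Cp ^ 2 + 32 * (2 * L) ^ 2 * VL * σ ^ 3 + 192 * (2 * L) ^ 2 * VL ^ 2 * σ ^ 6) with hK₁
  set K₂ : ℝ := 2 * (Cg * Cχ / κ) ^ 2 * (8 * (2 * L) ^ 2 * VL ^ 2 * σ ^ 6) with hK₂
  set K₃ : ℝ := 2 * (2 * L * Cχ * Cp / κ) ^ 2 * 2 with hK₃
  set K₄ : ℝ := 2 * (2 * L * Cχ * Cp / κ) ^ 2 * (8 * Cg ^ 2) with hK₄
  have hVL0 : 0 ≤ VL := by rw [hVL]; positivity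
  have hK₁0 : 0 ≤ K₁ := by rw [hK₁]; positivity
  have hK₂0 : 0 ≤ K₂ := by rw [hK₂]; positivity
  have hK₃0 : 0 ≤ K₃ := by rw [hK₃]; positivity
  have hK₄0 : 0 ≤ K₄ := by rw [hK₄]; positivity
  have hς4 : 0 < ς / 4 := by positivity
  -- the small parameters
  obtain ⟨ζ, hζ, -, hζK⟩ := exists_pos_mul_le hK₂0 hς4
  obtain ⟨ζ', hζ', hζ'1, hζ'K⟩ := exists_pos_mul_le hK₃0 hς4
  obtain ⟨δ, hδ, hmod⟩ := exists_modulus_at_cube hg hσ hζ'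
  obtain ⟨η₄, hη₄, -, hη₄K⟩ := exists_pos_mul_le hK₄0 hς4
  -- the thresholds in `N`
  obtain ⟨N₂, hN₂⟩ := exists_hsDiameter_mul_lt σ (1 + 2 * L * κ)
  obtain ⟨N₃, hN₃⟩ := hPl σ hσ hσ1 ζ hζ
  obtain ⟨N₄, hN₄⟩ := exists_posGibbs_sqDevEvent_le hsd one_pos hr hr2 hδ hη₄
  obtain ⟨N₅, hN₅⟩ := exists_nat_div_succ_le K₁ hς4
  refine ⟨max (max (max 1 N₂) (max N₃ N₄)) N₅, fun N hN k l t ht => ?_⟩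
  have hN1 : 1 ≤ N := le_trans (le_trans (le_trans (le_max_left _ _) (le_max_left _ _)) (le_max_left _ _)) hN
  have hN2' : N₂ ≤ N := le_trans (le_trans (le_trans (le_max_right _ _) (le_max_left _ _)) (le_max_left _ _)) hN
  have hN3' : N₃ ≤ N := le_trans (le_trans (le_trans (le_max_left _ _) (le_max_right _ _)) (le_max_left _ _)) hN
  have hN4' : N₄ ≤ N := le_trans (le_trans (le_trans (le_max_right _ _) (le_max_right _ _)) (le_max_left _ _)) hN
  have hN5' : N₅ ≤ N := le_trans (le_max_right _ _) hN
  -- the weight `h = χ(t, ·)/C_χ` fed to the plateau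
  have hhm : Measurable fun y : T3 => χ (t, y) / Cχ := (hχ.comp (Continuous.prodMk_right t)).measurable.div_const _
  have hh1 : ∀ y : T3, |χ (t, y) / Cχ| ≤ 1 := fun y => by
    rw [abs_div, abs_of_pos hCχ, div_le_one hCχ]; exact hχb t ht y
  have hdec := fun (i j i' j' : Fin (N + 1)) (hij : i ≠ j) (hii' : i ≠ i') (hij' : i ≠ j') (hji' : j ≠ i')
    (hjj' : j ≠ j') (hi'j' : i' ≠ j') (T T' : Set T3) (hT : MeasurableSet T) (hT' : MeasurableSet T') =>
    hN₃ N hN3' i j i' j' hij hii' hij' hji' hjj' hi'j' (fun y => χ (t, y) / Cχ) (fun y => χ (t, y) / Cχ) hhm hhm hh1 hh1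
      T T' hT hT'
  -- the Literature bound
  have hmain := variance_tubeStat_rung0_le hsd ha hθ u hN1 (Φ N) hχ hCχ t (hχb t ht) hg hCg k l hL0 hκ hr
    (hN₂ N hN2') hζ.le hdec hζ'.le hδ hmod
  -- the four terms
  have h1 : K₁ / ((N + 1 : ℕ) : ℝ) ≤ ς / 4 := hN₅ N hN5'
  have h2 : K₂ * ζ ≤ ς / 4 := hζK
  have h3 : K₃ * ζ' ^ 2 ≤ ς / 4 := by
    have hsq : ζ' ^ 2 ≤ ζ' := by
      calc ζ' ^ 2 = ζ' * ζ' := sq ζ'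
        _ ≤ ζ' * 1 := mul_le_mul_of_nonneg_left hζ'1 hζ'.le
        _ = ζ' := mul_one ζ'
    exact (mul_le_mul_of_nonneg_left hsq hK₃0).trans hζ'K
  have h4 : K₄ * (posGibbsMeasure (fun _ : T3 => (1 : ℝ)) (hsDiameter σ N) (N + 1)).real (sqDevEvent (N + 1) δ r) ≤ ς / 4 :=
    (mul_le_mul_of_nonneg_left (hN₄ N hN4') hK₄0).trans hη₄K
  have hsum : 2 * (Cg * Cχ / κ) ^ 2 *
        ((64 * L ^ 2 * ((3 + 4 * L * κ) ^ 3) ^ 2 + 32 * (2 * L) ^ 2 * (4 / 3 * Real.pi * (1 + 2 * L * κ) ^ 3) * σ ^ 3 +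
            192 * (2 * L) ^ 2 * (4 / 3 * Real.pi * (1 + 2 * L * κ) ^ 3) ^ 2 * σ ^ 6) / (N + 1 : ℕ) +
          8 * ζ * (2 * L) ^ 2 * (4 / 3 * Real.pi * (1 + 2 * L * κ) ^ 3) ^ 2 * σ ^ 6) +
        2 * (2 * L * Cχ * (3 + 4 * L * κ) ^ 3 / κ) ^ 2 * (2 * ζ' ^ 2 + 8 * Cg ^ 2 *
          (posGibbsMeasure (fun _ : T3 => (1 : ℝ)) (hsDiameter σ N) (N + 1)).real (sqDevEvent (N + 1) δ r)) =
      K₁ / ((N + 1 : ℕ) : ℝ) + K₂ * ζ + K₃ * ζ' ^ 2 +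
        K₄ * (posGibbsMeasure (fun _ : T3 => (1 : ℝ)) (hsDiameter σ N) (N + 1)).real (sqDevEvent (N + 1) δ r) := by
    rw [hK₁, hK₂, hK₃, hK₄, hCp, hVL]; ring
  rw [hsum] at hmain
  linarith only [hmain, h1, h2, h3, h4]

end Summit.AtomisticToContinuum.HydrodynamicLimit.Theorems.EvenStressEnskog

end
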